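import Summits.ResolutionOfSingularities.ResolutionOfSingularities.Theorems.HilbertSamuelEliminationSigmaMaxModificationsCorridor3PsiStable
import Summits.ResolutionOfSingularities.ResolutionOfSingularities.Theorems.HilbertSamuelEliminationSigmaMaxModificationsCorridor3WLadderForcedGameTowers
import Summits.ResolutionOfSingularities.ResolutionOfSingularities.Theorems.HilbertSamuelEliminationSigmaMaxModificationsCorridor3WLadderMovingIsoDefs
import Summits.ResolutionOfSingularities.ResolutionOfSingularities.Theorems.HilbertSamuelEliminationSigmaMaxModificationsCorridor3HypersurfaceHilbertFunction
import Literature.AlgebraicGeometry.Resolution.PointBlowupHilbertSamuelStrata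
import Literature.AlgebraicGeometry.Resolution.PointBlowupHsFunMono
import Literature.AlgebraicGeometry.Resolution.PointBlowupResiduallyFinite
import HarnessLib

/-!
# [OURS · L1 W4.2] D14 ROUTE H — objects H1 and H3: the Hilbert function of the local rings is CONSTANT along a
# tower of blow-ups with constant `H^N` at closed marked points (`ψ` and `dim 𝒪` do not move), and the Hilbert–Samuel
# function `H^{(0)}` of a hypersurface local ring (stub-1's H1′ at `t = 0`)

Cell res-hironaka, rung L, slot W4.2 (crux `SigmaMaxModificationsCorridor3`, stmt-ResolutionOfSingularities-19249); row
`stub_Wtop3M_pointed`, KERNEL K1 `IsoFreeRationalTailsImpossible` (C5 Defs `…Corridor3WLadderIsoProximityDefs`); res-L1-w42-lead-1's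
D14 BRIDGE CUT (ROUTE H), objects **H1** («`ψ` constant along the tower ⇒ `H^{(0)}(𝒪_{X_n,x_n}) = H^{(0)}(𝒪_{X_{n'},x_{n'}})`»)
and **H3** («HS ↔ multiplicity for hypersurface local rings»), dealt to res-type-001 (RULINGS v3.14-2 (AZ)).

H1 is res-type-071's `ψ`-stability (`…Corridor3PsiStable`, canonical near chains of `MarkedStage`s) RE-RUN ON A `BlowupTower` with
marked points `pt n`, `π_n(x_{n+1}) = x_n`, `x_n` closed, `H^N_{X_n}(x_n) = ν` for all `n` (the data of `IsIsoPointTower`): at each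
step `π_n` is a blow-up of a locally noetherian excellent stage (excellence and `dim ≤ N` propagate: `IdeasL1C4.isExcellent_stage`,
`IsBlowup.topologicalKrullDim_le_of_isLocallyNoetherian`), so `ψ(x_n) ≤ ψ(x_{n+1})` (CJS (3.7) with `δ = 0`,
`IsBlowup.hsPsi_le_of_residuallyIntegral`: universal catenarity from excellence, residual integrality at a closed point),
`dim 𝒪_{x_{n+1}} ≤ dim 𝒪_{x_n} ≤ N` (`IsBlowup.ringKrullDim_stalk_le_of_isLocallyNoetherian`), and the equality
`H^{(N−ψ')}(𝒪') = H^{(N−ψ)}(𝒪)` forces `ψ' = ψ`, `dim 𝒪' = dim 𝒪`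
(`Moving.minimalPrimesCodim_eq_and_ringKrullDim_eq_of_hilbertSamuelFun_eq`, CJS Lemma 2.25 (b)); partial summation being
injective (`iterPSum_injective`), the UNSHIFTED Hilbert functions agree: `hilbertFun_stalk_eq_of_tower`,
`hilbertSamuelFun_stalk_eq_of_tower` (every `H^{(t)}`), packaged for `IsIsoPointTower` over a maximal origin as
`hilbertSamuelFun_stalk_eq_of_isIsoPointTower`.

H3 is ≥ 90 % in the tree and is CITED, not restated: `Helpers.stub_H1_hilbertFun_quotient_span_singleton` /
`Helpers.hilbertFun_quotient_span_singleton` (`H^{(0)}(R/(g)) = hypersurfaceHFe e m`), `Helpers.hypersurfaceHFe_injective`,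
`…_mono_right`, `…_le_iff` (`…Corridor3HypersurfacePoints`), the `ψ`-shift `psum_hypersurfaceHFe_succ` / `iterPSum_hypersurfaceHFe_succ`
(`…Corridor3HypersurfaceValues`), and Bennett at ANY point `Helpers.hsFun_eq_hypersurfaceHFe_of_stalk_ringEquiv`. The one corollary
filed here is the `t = 0` Hilbert–SAMUEL form the bridge cut names (`hilbertSamuelFun_zero_quotient_span_singleton`).

[OURS · L1 W4.2] bookkeeping; NOT a statement of any source, and NOT a statement of H. Hironaka's 2017 manuscript. AI-written
(res-type-001 g7); AI review is weaker than expert review.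
-/

set_option linter.dupNamespace false

noncomputable section

open CategoryTheory AlgebraicGeometry TopologicalSpace IsLocalRing
open Literature.AlgebraicGeometry.Resolution Literature.RingTheory.HilbertSamuel
open Literature.AlgebraicGeometry.CossartJannsenSaito2020
open Summit.ResolutionOfSingularities.ResolutionOfSingularities.Theorems.CampaignW42
open Summit.ResolutionOfSingularities.ResolutionOfSingularities.Theorems.SigmaMaxModificationsCorridor3.Helpers
open Summit.ResolutionOfSingularities.ResolutionOfSingularities.Cruxes.SigmaMaxModifications.IdeasL1C4
open Summit.ResolutionOfSingularities.ResolutionOfSingularities.Cruxes.SigmaMaxModifications.IdeasL1Idea2R4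

namespace Summit.ResolutionOfSingularities.ResolutionOfSingularities.Theorems.SigmaMaxModificationsCorridor3.IsoTailsHS

universe u

/-! ## H3 — the Hilbert–Samuel function `H^{(0)}` of a hypersurface local ring (stub-1's H1′, `t = 0` form) -/

/-- **H3 (D14 ROUTE H): `H^{(0)}(R/(h)) = hypersurfaceHFe e m`** for `R` regular local of dimension `e` and
`h ∈ 𝔪^m ∖ 𝔪^{m+1}` — the Hilbert–SAMUEL function at `t = 0` is the Hilbert function (`hilbertSamuelFun_zero`), which is
stub-1's H1′ `stub_H1_hilbertFun_quotient_span_singleton`. Injectivity / monotonicity in `m` and the `ψ`-shift in `e` are the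
tree's `hypersurfaceHFe_injective`, `hypersurfaceHFe_mono_right`, `psum_hypersurfaceHFe_succ`.
[cite: CossartJannsenSaito2020, Thm. 2.3, §2.2 (p. 27)] -/
theorem hilbertSamuelFun_zero_quotient_span_singleton {R : Type u} [CommRing R] [IsRegularLocalRing R] {e m : ℕ}
    (he : ringKrullDim R = e) {h : R} (hm : h ∈ maximalIdeal R ^ m) (hm' : h ∉ maximalIdeal R ^ (m + 1))
    [IsLocalRing (R ⧸ Ideal.span {h})] :
    hilbertSamuelFun (R ⧸ Ideal.span {h}) 0 = hypersurfaceHFe e m := by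
  rw [hilbertSamuelFun_zero]
  exact stub_H1_hilbertFun_quotient_span_singleton he hm hm'

/-! ## H1 — `ψ`, `dim 𝒪` and `H^{(0)}` along a tower with constant `H^N` at closed marked points -/

section Tower

variable (T : BlowupTower.{u}) {N : ℕ} {ν : ℕ → ℕ} (pt : ∀ n, T.X n)

/-- Excellence of every stage from excellence of the first (`IdeasL1C4.isExcellent_stage`). [folklore] -/
theorem isExcellent_X (hexc : Scheme.IsExcellent (T.X 0)) (n : ℕ) : Scheme.IsExcellent (T.X n) :=
  isExcellent_stage T hexc n

/-- `dim X_n ≤ N` for every stage if `dim X_0 ≤ N` (blow-ups do not raise the dimension,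
`IsBlowup.topologicalKrullDim_le_of_isLocallyNoetherian`). [cite: Matsumura1987, Thm. 15.5] -/
theorem topologicalKrullDim_X_le (hdim : topologicalKrullDim ↥(T.X 0) ≤ (N : WithBot ℕ∞)) (n : ℕ) :
    topologicalKrullDim ↥(T.X n) ≤ (N : WithBot ℕ∞) := by
  induction n with
  | zero => exact hdim
  | succ n ih =>
    haveI : IsLocallyNoetherian (T.X n) := T.ln n
    exact (T.isBlowup n).topologicalKrullDim_le_of_isLocallyNoetherian ih

/-- `dim 𝒪_{X_n,y} ≤ N` for every point of every stage. [folklore] -/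
theorem ringKrullDim_stalk_le (hdim : topologicalKrullDim ↥(T.X 0) ≤ (N : WithBot ℕ∞)) (n : ℕ) (y : T.X n) :
    ringKrullDim ((T.X n).presheaf.stalk y) ≤ (N : WithBot ℕ∞) := by
  refine le_trans ?_ (topologicalKrullDim_X_le T hdim n)
  rw [AlgebraicGeometry.ringKrullDim_stalk_eq_coheight, topologicalKrullDim,
    Order.krullDim_eq_of_orderIso (irreducibleSetEquivPoints (α := T.X n))]
  exact Order.coheight_le_krullDim y

variable {T pt}

/-- **ONE STEP: `ψ` and `dim 𝒪` do not move** along `π_n` at the marked points when `X_n` is excellent of dimension `≤ N`,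
`x_{n+1}` is closed over `x_n` and `H^N_{X_{n+1}}(x_{n+1}) = H^N_{X_n}(x_n)` (res-type-071's genuine-step argument for an
arbitrary blow-up `π_n`). [cite: CossartJannsenSaito2020, Thm. 3.10 (1) (proof, (3.7)–(3.8)), Lemma 2.25 (b)] -/
theorem hsPsi_eq_and_ringKrullDim_stalk_eq_succ (n : ℕ) (hexc : Scheme.IsExcellent (T.X n))
    (hdimN : topologicalKrullDim ↥(T.X n) ≤ (N : WithBot ℕ∞)) (hpt : (T.π n).base (pt (n + 1)) = pt n)
    (hcl : IsClosed ({pt (n + 1)} : Set (T.X (n + 1))))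
    (hH : Scheme.hsFun (T.X (n + 1)) N (pt (n + 1)) = Scheme.hsFun (T.X n) N (pt n)) :
    Scheme.hsPsi (T.X (n + 1)) (pt (n + 1)) = Scheme.hsPsi (T.X n) (pt n) ∧
      ringKrullDim ((T.X (n + 1)).presheaf.stalk (pt (n + 1))) = ringKrullDim ((T.X n).presheaf.stalk (pt n)) := by
  haveI : IsLocallyNoetherian (T.X n) := T.ln n
  haveI : IsLocallyNoetherian (T.X (n + 1)) := T.ln (n + 1)
  have hπ := T.isBlowup n
  haveI : IsProper (T.π n) := hπ.isProper
  -- (a) `ψ(x_n) ≤ ψ(x_{n+1})`: universal catenarity from excellence, residual integrality at a closed point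
  have hUC : IsUniversallyCatenaryRing ((T.X n).presheaf.stalk ((T.π n).base (pt (n + 1)))) :=
    hexc.isUniversallyCatenaryRing_stalk _
  have hfin := finite_residueFieldMap_of_isClosed (T.π n) hcl
  obtain ⟨S, hSgen, hSint⟩ := exists_residuallyFinite_of_finite_residueField ((T.π n).stalkMap (pt (n + 1))).hom hfin
  have hint := exists_monic_map_eval_mem_of_residuallyFinite ((T.π n).stalkMap (pt (n + 1))).hom S hSgen hSint
  have hψle : Scheme.hsPsi (T.X n) ((T.π n).base (pt (n + 1))) ≤ Scheme.hsPsi (T.X (n + 1)) (pt (n + 1)) :=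
    hπ.hsPsi_le_of_residuallyIntegral (pt (n + 1)) hUC hint
  -- (b) `dim 𝒪_{x_{n+1}} ≤ dim 𝒪_{x_n}`
  have hdimle : ringKrullDim ((T.X (n + 1)).presheaf.stalk (pt (n + 1))) ≤
      ringKrullDim ((T.X n).presheaf.stalk ((T.π n).base (pt (n + 1)))) :=
    hπ.ringKrullDim_stalk_le_of_isLocallyNoetherian (pt (n + 1))
  rw [hpt] at hψle hdimle
  -- `dim 𝒪_{x_n} ≤ dim X_n ≤ N`
  have hN : ringKrullDim ((T.X n).presheaf.stalk (pt n)) ≤ (N : WithBot ℕ∞) := by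
    refine le_trans ?_ hdimN
    rw [AlgebraicGeometry.ringKrullDim_stalk_eq_coheight, topologicalKrullDim,
      Order.krullDim_eq_of_orderIso (irreducibleSetEquivPoints (α := T.X n))]
    exact Order.coheight_le_krullDim (pt n)
  -- (c)+(d)
  have hH' : hilbertSamuelFun ((T.X (n + 1)).presheaf.stalk (pt (n + 1)))
        (N - minimalPrimesCodim ((T.X (n + 1)).presheaf.stalk (pt (n + 1)))) =
      hilbertSamuelFun ((T.X n).presheaf.stalk (pt n)) (N - minimalPrimesCodim ((T.X n).presheaf.stalk (pt n))) := hH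
  exact Moving.minimalPrimesCodim_eq_and_ringKrullDim_eq_of_hilbertSamuelFun_eq hH' hψle hdimle hN

/-- **H1 (D14 ROUTE H): `ψ` and `dim 𝒪_{X_n,x_n}` are CONSTANT along a tower of blow-ups with marked closed points
`x_{n+1} ↦ x_n` and constant `H^N_{X_n}(x_n) = ν`**, the first stage being excellent of dimension `≤ N`.
[cite: CossartJannsenSaito2020, Def. 2.28 (2), Thm. 3.10 (1)] -/
theorem hsPsi_eq_and_ringKrullDim_stalk_eq_of_tower (hexc : Scheme.IsExcellent (T.X 0))
    (hdim : topologicalKrullDim ↥(T.X 0) ≤ (N : WithBot ℕ∞)) (hpt : ∀ n, (T.π n).base (pt (n + 1)) = pt n)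
    (hcl : ∀ n, IsClosed ({pt n} : Set (T.X n))) (hH : ∀ n, Scheme.hsFun (T.X n) N (pt n) = ν) (n : ℕ) :
    Scheme.hsPsi (T.X n) (pt n) = Scheme.hsPsi (T.X 0) (pt 0) ∧
      ringKrullDim ((T.X n).presheaf.stalk (pt n)) = ringKrullDim ((T.X 0).presheaf.stalk (pt 0)) := by
  induction n with
  | zero => exact ⟨rfl, rfl⟩
  | succ n ih =>
    have h := hsPsi_eq_and_ringKrullDim_stalk_eq_succ n (isExcellent_X T hexc n) (topologicalKrullDim_X_le T hdim n)
      (hpt n) (hcl (n + 1)) (by rw [hH (n + 1), hH n])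
    exact ⟨h.1.trans ih.1, h.2.trans ih.2⟩

/-- **H1, Hilbert-function form: `H^{(0)}(𝒪_{X_n,x_n}) = H^{(0)}(𝒪_{X_0,x_0})` along such a tower** — `ψ` is constant, so the
equality `H^N = (H^{(0)})^{(N−ψ)}` has the same shift at every stage, and partial summation is injective
(`iterPSum_injective`, CJS Rem. 2.29 (b)). [cite: CossartJannsenSaito2020, Def. 2.28, Rem. 2.29 (b)] -/
theorem hilbertFun_stalk_eq_of_tower (hexc : Scheme.IsExcellent (T.X 0))
    (hdim : topologicalKrullDim ↥(T.X 0) ≤ (N : WithBot ℕ∞)) (hpt : ∀ n, (T.π n).base (pt (n + 1)) = pt n)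
    (hcl : ∀ n, IsClosed ({pt n} : Set (T.X n))) (hH : ∀ n, Scheme.hsFun (T.X n) N (pt n) = ν) (n : ℕ) :
    hilbertFun ((T.X n).presheaf.stalk (pt n)) = hilbertFun ((T.X 0).presheaf.stalk (pt 0)) := by
  haveI : IsLocallyNoetherian (T.X n) := T.ln n
  haveI : IsLocallyNoetherian (T.X 0) := T.ln 0
  have hψ := (hsPsi_eq_and_ringKrullDim_stalk_eq_of_tower hexc hdim hpt hcl hH n).1
  have h := (hH n).trans (hH 0).symm
  rw [Scheme.hsFun_def, Scheme.hsFun_def, hψ] at h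
  exact iterPSum_injective _ h

/-- **H1, every `H^{(t)}`: `H^{(t)}(𝒪_{X_n,x_n}) = H^{(t)}(𝒪_{X_0,x_0})`** along such a tower.
[cite: CossartJannsenSaito2020, Def. 2.28, Rem. 2.29 (b)] -/
theorem hilbertSamuelFun_stalk_eq_of_tower (hexc : Scheme.IsExcellent (T.X 0))
    (hdim : topologicalKrullDim ↥(T.X 0) ≤ (N : WithBot ℕ∞)) (hpt : ∀ n, (T.π n).base (pt (n + 1)) = pt n)
    (hcl : ∀ n, IsClosed ({pt n} : Set (T.X n))) (hH : ∀ n, Scheme.hsFun (T.X n) N (pt n) = ν) (n t : ℕ) :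
    hilbertSamuelFun ((T.X n).presheaf.stalk (pt n)) t = hilbertSamuelFun ((T.X 0).presheaf.stalk (pt 0)) t := by
  rw [hilbertSamuelFun, hilbertSamuelFun, hilbertFun_stalk_eq_of_tower hexc hdim hpt hcl hH n]

end Tower

/-! ## H1 packaged for an isolated point tower over a maximal origin -/

/-- **H1 for `IsIsoPointTower` over a maximal origin (the K1 setting)**: along an isolated E3 point tower over a maximal origin of
characteristic `p` at level `N`, every Hilbert–Samuel function `H^{(t)}` of the local ring `𝒪_{X_n,x_n}` equals that of
`𝒪_{X_0,x_0}` (the origin is excellent — `IdeasL1C4.isExcellent_of_isMaximalOrigin` — of dimension `≤ N`; the tower datum gives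
`π_n(x_{n+1}) = x_n`, closed points and `H^N = ν`). In particular multiplicities read through H3 are constant along the tower.
[OURS · L1 W4.2; AI-written] -/
theorem hilbertSamuelFun_stalk_eq_of_isIsoPointTower {p N : ℕ} {ν : ℕ → ℕ} {T : BlowupTower.{u}} {pt : ∀ n, T.X n}
    (hO : IsMaximalOrigin p N ν (T.X 0) (pt 0)) (hT : IsIsoPointTower N ν T pt) (n t : ℕ) :
    hilbertSamuelFun ((T.X n).presheaf.stalk (pt n)) t = hilbertSamuelFun ((T.X 0).presheaf.stalk (pt 0)) t :=
  hilbertSamuelFun_stalk_eq_of_tower (isExcellent_of_isMaximalOrigin hO) hO.dim_le hT.2.1 hT.2.2.1 hT.2.2.2.1 n t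

/-- Along an isolated point tower over a maximal origin, `ψ(x_n) = ψ(x_0)` and `dim 𝒪_{X_n,x_n} = dim 𝒪_{X_0,x_0}`.
[OURS · L1 W4.2; AI-written] -/
theorem hsPsi_eq_and_ringKrullDim_stalk_eq_of_isIsoPointTower {p N : ℕ} {ν : ℕ → ℕ} {T : BlowupTower.{u}}
    {pt : ∀ n, T.X n} (hO : IsMaximalOrigin p N ν (T.X 0) (pt 0)) (hT : IsIsoPointTower N ν T pt) (n : ℕ) :
    Scheme.hsPsi (T.X n) (pt n) = Scheme.hsPsi (T.X 0) (pt 0) ∧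
      ringKrullDim ((T.X n).presheaf.stalk (pt n)) = ringKrullDim ((T.X 0).presheaf.stalk (pt 0)) :=
  hsPsi_eq_and_ringKrullDim_stalk_eq_of_tower (isExcellent_of_isMaximalOrigin hO) hO.dim_le hT.2.1 hT.2.2.1 hT.2.2.2.1 n

end Summit.ResolutionOfSingularities.ResolutionOfSingularities.Theorems.SigmaMaxModificationsCorridor3.IsoTailsHS

end
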